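import Summits.KontsevichZagierPeriods.KontsevichZagierPeriods.Theses.Deregularisation
import Literature.NumberTheory.Transcendental.KZRegCalculusProofs
import Literature.NumberTheory.Transcendental.KZKernelConjectureForms

/-!
# `RegKernel2` (stmt-KontsevichZagierPeriods-4954): negative side — the target shape is false as typed, and its repair restates the summit

Negative-side record for the item `RegKernel` / `RegKernel2` of route `Deregularisation`
(refuter crux-attack seat). The item is informal in the route file (rev 5 carries it as a comment,
no `def RegKernel2`), but its text fixes the target Lean shape verbatim:
`∀ c : KZreg.FormalRep, KZreg.eval c = 0 → c ∈ KZreg.relations`, over the regularised calculus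
`KZreg` of `Literature/NumberTheory/Transcendental/KZRegCalculus.lean` (the fulfilled definition
request `defn-KZreg` of the same route). This file records, kernel-checked and importable:

* §1 `targetShape_iff_kernelConjecture` (`Iff.rfl`): the target shape IS the registered open
  statement `KZreg.KernelConjecture`; `not_targetShape`: it is FALSE (the tree's
  `KZreg.not_kernelConjecture` — the unit pole `[(0,1), dt/(1-t); {0}]` has regularised value `0`
  and residue value `1`, and the four moves preserve the residue functional `KZreg.res`).
* §2 the witness MISSES the minimal repair `ker eval ≤ relations ⊔ defects`
  (`of_unitPole_mem_relations_sup_defects`, via `Λ [unitPole] = [(0,1) ∪ collar, 0] ∈ KZ.relations`):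
  the refutation is of the *misstated* class — the landed move set has no move paying a pure
  divergence — not a failure of the intended kernel principle.
* §3 RESTATES-THE-TARGET: the repaired item together with the route's other standing hypothesis
  `KZreg.Conservative` (item RegConservative) is *equivalent* to the summit
  (`conservative_and_repaired_iff_summit`), and on its own a *consequence* of the summit
  (`repaired_of_summit`); so the repaired X2 has no content independent of Conjecture 1 and cannot
  be refuted without refuting the summit.

Nothing here asserts a Theses declaration. Sources: C. Dupont, E. Panzer, B. Pym, *Regularized
integrals and manifolds with log corners*, J. Éc. polytech. Math. 13 (2026), Ex. 7.13 (as vendored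
in `KZRegCalculus.lean`); M. Kontsevich, D. Zagier, *Periods* (2001), §1.2.
-/

noncomputable section

open Literature.NumberTheory.Transcendental

namespace Summit.KontsevichZagierPeriods.RegKernel2.Negative

/-! ### §1 The target shape, read back and refuted -/

/-- The item's verbatim target shape is *syntactically* the registered open statement
`KZreg.KernelConjecture`. [folklore] -/
theorem targetShape_iff_kernelConjecture :
    (∀ c : KZreg.FormalRep, KZreg.eval c = 0 → c ∈ KZreg.relations) ↔ KZreg.KernelConjecture :=
  Iff.rfl

/-- The witness: the unit pole has regularised value `0` and is not a relation of `KZreg`.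
[folklore] -/
theorem unitPole_witness :
    KZreg.eval (KZreg.of KZreg.unitPole) = 0 ∧ KZreg.of KZreg.unitPole ∉ KZreg.relations :=
  ⟨KZreg.eval_of_unitPole, KZreg.of_unitPole_not_mem_relations⟩

/-- **The target shape of `RegKernel2` is false** for the landed calculus `KZreg`
(= `KZreg.not_kernelConjecture`). [folklore] -/
theorem not_targetShape : ¬ (∀ c : KZreg.FormalRep, KZreg.eval c = 0 → c ∈ KZreg.relations) :=
  KZreg.not_kernelConjecture

/-! ### §2 The witness misses the repaired statement `ker eval ≤ relations ⊔ defects` -/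

/-- The subtracted integrand of the unit pole vanishes identically (the computation inside the
tree's `KZreg.value_unitPole`, recorded as an equation). [folklore] -/
theorem subIntegrand_unitPole : KZreg.unitPole.subIntegrand = 0 := by
  funext t
  rw [KZreg.IntegralRep.subIntegrand, KZreg.IntegralRep.resSys]
  change KZreg.rem {0} (KZreg.resSys KZreg.unitIoo (fun _ => (1 : ℝ)) {0}) ∅ t = 0
  rw [KZreg.rem]
  have hps : (({0} : Finset (Fin 1)) \ ∅).powerset = {∅, {0}} := by decide
  rw [hps, Finset.sum_pair (by decide)]
  simp only [Finset.card_empty, pow_zero, Finset.empty_union, KZreg.divProd_empty, div_one, one_mul,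
    Finset.card_singleton, pow_one, KZreg.resSys, KZreg.cyl_empty, KZreg.cyl_zero_unitIoo]
  by_cases ht : t ∈ KZreg.unitIoo
  · simp only [Set.indicator_of_mem ht, KZreg.faceIntegrand, KZreg.divProd, Finset.sdiff_empty,
      Finset.prod_singleton, Finset.sdiff_self, Finset.prod_empty]
    ring
  · simp [Set.indicator_of_notMem ht]

/-- The de-regularisation of the unit pole, `[(0,1) ∪ collar, 0]`, is a KZ relation (integrand
additivity `0 = 0 + 0`). [folklore] -/
theorem Λ_of_unitPole_mem_relations : KZreg.Λ (KZreg.of KZreg.unitPole) ∈ KZ.relations := by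
  rw [KZreg.Λ_of]
  set r := KZreg.unitPole.mainPiece
  have h0 : Set.EqOn r.integrand (r.integrand + r.integrand) r.domain := by
    intro t ht
    have h1 : r.integrand t = 0 := by
      have := KZreg.IntegralRep.mainIntegrand_eq_subIntegrand KZreg.unitPole ht
      rw [subIntegrand_unitPole] at this
      exact this
    simp [h1]
  have hmem : KZ.of r - KZ.of r - KZ.of r ∈ KZ.integrandAddRel := ⟨1, r, r, r, rfl, rfl, h0, rfl⟩
  have := KZ.relations.neg_mem (KZ.integrandAddRel_subset_relations hmem)
  simpa using this

/-- **The witness misses the repair**: `[unitPole] ∈ relations ⊔ defects`, since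
`[unitPole] = incl (Λ [unitPole]) + regDefect unitPole` with the first summand the inclusion of a
KZ relation and the second a regularisation defect. [folklore] -/
theorem of_unitPole_mem_relations_sup_defects :
    KZreg.of KZreg.unitPole ∈ KZreg.relations ⊔ KZreg.defects := by
  have h1 : KZreg.incl (KZreg.Λ (KZreg.of KZreg.unitPole)) ∈ KZreg.relations :=
    KZreg.map_relations_le ⟨_, Λ_of_unitPole_mem_relations, rfl⟩
  have h2 := KZreg.regDefect_mem_defects KZreg.unitPole
  have h3 : KZreg.of KZreg.unitPole =
      KZreg.incl (KZreg.Λ (KZreg.of KZreg.unitPole)) + KZreg.regDefect KZreg.unitPole := by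
    rw [KZreg.regDefect]; abel
  rw [h3]
  exact AddSubgroup.add_mem_sup h1 h2

/-! ### §3 Restates-the-target: the repaired item is summit-strength, jointly and as a consequence -/

/-- **Repaired X2 ∧ X1 ↔ summit.** With the regularisation defects adjoined, RegKernel together
with RegConservative (`KZreg.Conservative`) is exactly Conjecture 1 as formalised
(`KZreg.conservative_and_ker_le_iff`; the summit is the ordinary kernel conjecture by the tree's
`kzKernelConjecture_iff_isRational`, whose right-hand side is the summit's body verbatim — cf.
`summit_iff_kzKernelConjecture` in `Theorems/LogKernelConjecture/Negative/Sandwich.lean`).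
[folklore] -/
theorem conservative_and_repaired_iff_summit :
    (KZreg.Conservative ∧ KZreg.eval.ker ≤ KZreg.relations ⊔ KZreg.defects) ↔
      KontsevichZagierPeriods :=
  KZreg.conservative_and_ker_le_iff.trans
    (kzKernelConjecture_iff_isRational : KZKernelConjecture ↔ KontsevichZagierPeriods)

/-- **The repaired X2 alone follows from the summit**, so no refutation of it is cheaper than a
refutation of Conjecture 1. [folklore] -/
theorem repaired_of_summit (h : KontsevichZagierPeriods) :
    KZreg.eval.ker ≤ KZreg.relations ⊔ KZreg.defects :=
  KZreg.ker_eval_le_relations_sup_defects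
    ((kzKernelConjecture_iff_isRational : KZKernelConjecture ↔ KontsevichZagierPeriods).mpr h)

/-- The as-typed target shape restricted to CONVERGENT data (`D = ∅`, the image of `incl`) is
likewise a consequence of the summit (`map_relations_le`), hence not cheaply refutable either: the
falsity of the full shape lives entirely in the divergent representations. [folklore] -/
theorem targetShape_on_incl_of_summit (h : KontsevichZagierPeriods) (c : KZ.FormalRep)
    (hc : KZreg.eval (KZreg.incl c) = 0) : KZreg.incl c ∈ KZreg.relations := by
  rw [KZreg.eval_incl] at hc
  exact KZreg.map_relations_le
    ⟨c, (kzKernelConjecture_iff_isRational : KZKernelConjecture ↔ KontsevichZagierPeriods).mpr h c hc,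
      rfl⟩

end Summit.KontsevichZagierPeriods.RegKernel2.Negative
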